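import Mathlib
import Literature.Computability.AlgebraicComplexity.HessianAtOrigin
import Literature.Algebra.Polynomial.LaplacianOrthogonalInvariance
import Summits.ValiantsHypothesis.ValiantsHypothesis.Theorems.GrenetZeonTwoDimCoefficientsDefs

/-!
# Crux `GrenetZeon.TwoDimCoefficients` (stmt-ValiantsHypothesis-8062), stub `stub_dualUnipotent`:
# scaling-closure — HESSIAN RANK UNDER LINEAR SUBSTITUTION (brick T1 of memo EIGHTEENTH-HAND.md §R6)

The substitution route for the residual R6 (nil-index `> n`) of the 3/2 rung restricts a unipotent pencil to a linear
subspace of matrix space on which the nilpotent part has index `≤ n` and applies the per-free Hessian-rate law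
(✓ `rank_hess0_top_mul_le_of_index`).  What it needs about Hessians is folklore, typed here once:

* `rank_add_rank_le_rank_mul_add_card` — Sylvester's rank inequality `rank A + rank B ≤ rank (A·B) + (inner dimension)`;
* `rank_le_rank_transpose_mul_mul_add` — `rank H ≤ rank (Tᵀ·H·T) + 2·(N − rank T)`;
* ★ `hess0_transl_bind₁_linSubst` — chain rule: the Hessian of `P ∘ T` at `w` is `Tᵀ · Hess P (T w) · T`
  (`bind₁ (linSubst T)`, tree `Literature.Algebra.Polynomial.pderiv_bind₁_linSubst`);
* ★ `rank_hess0_transl_le_of_linSubst` — hence `rank Hess P (T w) ≤ rank Hess (P ∘ T)(w) + 2·(N − rank T)`: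
  a substitution of corank `κ` loses at most `2κ` of Hessian rank.

HONEST FRAMING: bookkeeping for a conditional bridge; the stub `DualUnipotentBound`, crux 8062, the 24318 decl for pencils of
nil-index `> n` and `VP ≠ VNP` remain open.

References: folklore (Sylvester's rank inequality; chain rule).
-/

-- single-conjunct layout `Summits/ValiantsHypothesis/ValiantsHypothesis`: the duplicated namespace
-- component is mandated by the tree.
set_option linter.dupNamespace false
set_option autoImplicit false

noncomputable section

namespace Summit.ValiantsHypothesis.ValiantsHypothesis.Theorems.GrenetZeonTwoDimCoefficients.ScalingClosure

open MvPolynomial Matrix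
open Literature.Computability.AlgebraicComplexity
open Literature.Algebra.Polynomial

/-! ### Sylvester's rank inequality -/

section Sylvester

variable {K : Type*} [Field K] {l m p : Type*} [Fintype l] [Fintype m] [Fintype p]

omit [Fintype l] in
/-- **Sylvester's rank inequality**: `rank A + rank B ≤ rank (A·B) + (inner dimension)`. [folklore] -/
theorem rank_add_rank_le_rank_mul_add_card (A : Matrix l m K) (B : Matrix m p K) :
    A.rank + B.rank ≤ (A * B).rank + Fintype.card m := by
  classical
  set f : (m → K) →ₗ[K] (l → K) := A.mulVecLin with hf
  set g : (p → K) →ₗ[K] (m → K) := B.mulVecLin with hg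
  set U : Submodule K (m → K) := LinearMap.range g with hU
  have hAB : (A * B).rank = Module.finrank K (U.map f) := by
    rw [Matrix.rank, Matrix.mulVecLin_mul, LinearMap.range_comp]
  have hB : B.rank = Module.finrank K U := rfl
  have hA : A.rank + Module.finrank K (LinearMap.ker f) = Fintype.card m := by
    rw [Matrix.rank, LinearMap.finrank_range_add_finrank_ker, Module.finrank_fintype_fun_eq_card]
  -- rank-nullity for `f` restricted to `U`
  have hres := LinearMap.finrank_range_add_finrank_ker (f.domRestrict U)
  rw [LinearMap.range_domRestrict, LinearMap.ker_domRestrict] at hres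
  have hker : Module.finrank K ((LinearMap.ker f).comap U.subtype) ≤ Module.finrank K (LinearMap.ker f) := by
    rw [← Submodule.finrank_map_subtype_eq U ((LinearMap.ker f).comap U.subtype), Submodule.map_comap_subtype]
    exact Submodule.finrank_mono inf_le_right
  have hUf : Module.finrank K U ≤ Module.finrank K (U.map f) + Module.finrank K (LinearMap.ker f) := by
    rw [← hres]; exact Nat.add_le_add_left hker _
  rw [hAB, hB]
  omega

/-- `rank H ≤ rank (Tᵀ·H·T) + 2·(N − rank T)` (`N` the size): a congruence by a matrix of corank `κ` loses at most `2κ`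
of rank. [folklore] -/
theorem rank_le_rank_transpose_mul_mul_add (T H : Matrix m m K) :
    H.rank ≤ (T.transpose * H * T).rank + 2 * (Fintype.card m - T.rank) := by
  have h1 := rank_add_rank_le_rank_mul_add_card (T.transpose * H) T
  have h2 := rank_add_rank_le_rank_mul_add_card T.transpose H
  have hT : T.transpose.rank = T.rank := Matrix.rank_transpose T
  have hle : T.rank ≤ Fintype.card m := Matrix.rank_le_card_width T
  omega

end Sylvester

/-! ### The Hessian under a linear substitution -/

section Substitution

variable {k : Type*} [CommRing k] {σ : Type*} [Fintype σ] [DecidableEq σ]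

/-- ★ **Chain rule for the Hessian**: for the linear substitution `xᵢ ↦ Σⱼ T i j xⱼ` (`(P ∘ T)(w) = P(T w)`),
`Hess (P ∘ T)(w) = Tᵀ · Hess P (T w) · T`. [folklore] -/
theorem hess0_transl_bind₁_linSubst (T : Matrix σ σ k) (P : MvPolynomial σ k) (w : σ → k) :
    hess0 (transl w (bind₁ (linSubst T) P)) = T.transpose * hess0 (transl (T.mulVec w) P) * T := by
  ext u t
  rw [hess0_transl, pderiv_bind₁_linSubst, map_sum]
  simp_rw [pderiv_C_mul, pderiv_bind₁_linSubst, Finset.mul_sum, map_sum, map_mul, MvPolynomial.eval_C,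
    eval_bind₁_linSubst]
  rw [Matrix.mul_apply]
  simp_rw [Matrix.mul_apply, Matrix.transpose_apply, hess0_transl, Finset.sum_mul]
  refine Finset.sum_congr rfl fun i _ => Finset.sum_congr rfl fun i' _ => ?_
  ring

variable {K : Type*} [Field K]

/-- ★ **A substitution of corank `κ` loses at most `2κ` of Hessian rank**:
`rank Hess P (T w) ≤ rank Hess (P ∘ T)(w) + 2·(#σ − rank T)`. [folklore] -/
theorem rank_hess0_transl_le_of_linSubst (T : Matrix σ σ K) (P : MvPolynomial σ K) (w : σ → K) :
    (hess0 (transl (T.mulVec w) P)).rank ≤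
      (hess0 (transl w (bind₁ (linSubst T) P))).rank + 2 * (Fintype.card σ - T.rank) := by
  rw [hess0_transl_bind₁_linSubst]
  exact rank_le_rank_transpose_mul_mul_add T _

end Substitution

end Summit.ValiantsHypothesis.ValiantsHypothesis.Theorems.GrenetZeonTwoDimCoefficients.ScalingClosure

end
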